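import Summits.CriticalPhenomena.SAWScalingLimit.Theorems.SAWDevelopingMapInteriorFlatteningLiouvilleHarnackChains
import Summits.CriticalPhenomena.SAWScalingLimit.Theorems.SAWDevelopingMapInteriorFlatteningLiouvilleExtraction
import Summits.CriticalPhenomena.SAWScalingLimit.Theorems.SAWDevelopingMapInteriorFlatteningLiouvilleBulkNoFold
import Summits.CriticalPhenomena.SAWScalingLimit.Theorems.SAWDevelopingMapInteriorFlatteningLiouvilleCompactnessB
import Summits.CriticalPhenomena.SAWScalingLimit.Theorems.SAWDevelopingMapInteriorFlatteningLiouvilleReductionC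

/-!
# Uniqueness reduction for `InteriorFlattening`: the stub `stub_uniquenessReduction` (S7)

Crux `stmt-CriticalPhenomena-8297`
(`Summit.CriticalPhenomena.SAWScalingLimit.Theses.SAWDevelopingMap.InteriorFlattening`), line
`liouville-local-limits`, registered stub `stub_uniquenessReduction` (S7, lead `c1`), proved here
from the three helper files `…LiouvilleReductionA/B/C` (topological lemma; uniform convergence of
clean alive rows; superposition in the window) by discharging their two analytic inputs:

* the lattice Harnack bound at `O` under bulk no-fold — `RatioAtDepth R₀ k` with `0 ≤ k < 1` is
  the one-mouth line's `DepthFlat R₀ k` (`BulkNoFold.ratioAtDepth_iff_depthFlat` of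
  `…LiouvilleBulkNoFold`), and `…LiouvilleHarnackChains` (`Harnack.Fobs_le_mono_of_deep`, base
  vertex `O` with its canonical frame `(A, B, C)`, a labelled star by `…LiouvilleCompactnessB`)
  gives `‖F(z)‖ ≤ C(z) ‖M(O)‖` for every edge `z` once `O` is `N(z)`-deep (`harnack_at_O`);
* the diagonal extraction of pointwise convergent subsequences of edgewise bounded lattice fields
  (`Extraction.extraction_subseq_tendsto` of `…LiouvilleExtraction`).

**Statement (S7).** Last-exit factorisation (S4) + windowed far-field coherence (S6) + windowed
intrusion tail (S6') transfer, under bulk no-fold, uniqueness of local limits from the sub-family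
of picture domains (`PicLimits.Subsingleton`, the core S5) to all admissible configurations
(`LocalLimits.Subsingleton`). The three hypotheses are spelled out verbatim (reshape r3/r4 of the
lead's skeleton), so the statement lives over the Defs module only.

Sources: H. Duminil-Copin, S. Smirnov, Ann. of Math. 175 (2012) 1653–1665 (arXiv:1007.0575),
§2 and Lemma 1; the line card `Cruxes/InteriorFlattening/Lines/liouville-local-limits.md`.
-/

noncomputable section

open scoped BigOperators Classical Topology
open Filter Literature.Probability.LatticeModels Literature.Probability.RandomPlanarGeometry.SAW

namespace Summit.CriticalPhenomena.SAWScalingLimit.Theorems.InteriorFlattening.Liouville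

namespace Reduction

/-! ### Bridging to the one-mouth Harnack chains -/

/-- The canonical frame at `O` is a labelled star. -/
theorem isStar_O : OneMouth.IsStar O nbA nbB nbC :=
  ⟨adj_O_nbA, adj_O_nbB, adj_O_nbC, Compactness.nbA_ne_nbB, Compactness.nbB_ne_nbC,
    Compactness.nbA_ne_nbC⟩

/-- **Lattice Harnack at `O` under bulk no-fold**, in the form parts B and C consume: for every
edge `z` there are `C, N` with `‖F(z)‖ ≤ C ‖M(O)‖` for every simply connected `Λ` with boundary
root `a` in which `O` is `N`-deep. -/
theorem harnack_at_O {k R₀ : ℝ} (hk0 : 0 ≤ k) (hk1 : k < 1) (hR : RatioAtDepth R₀ k) :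
    ∀ z ∈ hexGraph.edgeSet, ∃ C N : ℝ, ∀ (Λ : Finset HexVertex) (a : Sym2 HexVertex) (n : ℝ),
      N ≤ n → hexDomainSimplyConnected Λ → a ∈ hexDomainBoundary Λ → Deep Λ O n →
        ‖obs Λ a z‖ ≤ C * ‖obsMono Λ a‖ :=
  fun z hz =>
    Harnack.Fobs_le_mono_of_deep k R₀ hk0 hk1 (BulkNoFold.ratioAtDepth_iff_depthFlat.1 hR) O nbA nbB
      nbC isStar_O z hz

end Reduction

/-- **S7 — the uniqueness reduction** (registered stub of the line `liouville-local-limits`).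
Given the last-exit factorisation at one scale (S4), windowed far-field coherence (S6) and the
windowed intrusion tail (S6'), bulk no-fold `RatioAtDepth R₀ k` with `k < 1` and uniqueness of
picture limits, all lattice-scale local limits coincide. Proof: `Reduction.localLimits_subsingleton_of`
(parts A–C) with the lattice Harnack bound `Reduction.harnack_at_O` and the diagonal extraction
`Extraction.extraction_subseq_tendsto`. -/
theorem stub_uniquenessReduction :
    (∀ (D : Finset HexVertex) (ρ : Sym2 HexVertex) (S : ℝ) (p q : HexVertex),
      (∀ u ∈ ρ, u ∉ latticeBall S) → p ∈ latticeBall S → q ∈ latticeBall S → p ∈ D → q ∈ D →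
        obs D ρ s(p, q) = ∑ P ∈ Pic S, amp D ρ S P * obs (picDom D S P) (picRoot P) s(p, q)) →
    (∃ K S₁ : ℝ, ∀ S : ℝ, S₁ ≤ S → ∀ (Λ : Finset HexVertex) (a : Sym2 HexVertex),
      hexDomainSimplyConnected Λ → a ∈ hexDomainBoundary Λ → Deep Λ O (2 * S) → ¬ Deep Λ O (4 * S) →
        ∑ P ∈ Pic S, ‖amp Λ a S P‖ * ‖picMono S P‖ ≤ K * ‖obsMono Λ a‖) →
    (∀ r : ℝ, 1 ≤ r → ∀ sbar : ℝ, r ≤ sbar → ∀ δ : ℝ, 0 < δ → ∃ S₂ : ℝ, ∀ S : ℝ, S₂ ≤ S →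
      ∀ (Λ : Finset HexVertex) (a : Sym2 HexVertex),
        hexDomainSimplyConnected Λ → a ∈ hexDomainBoundary Λ → Deep Λ O (2 * S) → ¬ Deep Λ O (4 * S) →
          ∑ P ∈ (Pic S).filter (fun P => ¬ Clean sbar P),
              ‖amp Λ a S P‖ * ∑ e ∈ innerEdges r, ‖picField S P e‖ ≤
            δ * ∑ P ∈ Pic S, ‖amp Λ a S P‖ * ‖picMono S P‖) →
      ∀ k R₀ : ℝ, 0 ≤ k → k < 1 → RatioAtDepth R₀ k → PicLimits.Subsingleton →
        LocalLimits.Subsingleton := by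
  intro hFac hCoh hTail k R₀ hk0 hk1 hR hsub
  exact Reduction.localLimits_subsingleton_of hFac hCoh hTail (Reduction.harnack_at_O hk0 hk1 hR)
    Extraction.extraction_subseq_tendsto hsub

end Summit.CriticalPhenomena.SAWScalingLimit.Theorems.InteriorFlattening.Liouville

end
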